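import Summits.Ventures.HodgeRepro2.T5RecordSatakeInertToyDegree
import Summits.Ventures.HodgeRepro2.T5RecordSatakeDegreeCells

/-!
# The degrees of all the cells at the inert place `(3)` of `ℚ(i)`, as numerals: `deg Tₙ = 28 · 3^{4n−3}`

Tier-5 support N3 / §G-N4.2 (seat p3, gen 78). File 251 gives, at every place of `K⁺` that stays prime in the CM
field `K` and is good for `H`, cells `gₙ ∈ U(1 ⊗ H)` with `deg Tₙ = #(K_v gₙ K_v / K_v) = (N(v)³ + 1) N(v)^{4n−3}`
(`n ≥ 1`), `deg T₀ = 1`, and the tree recursion. This file reads it at the concrete inert place `(3)` of `ℚ(i)`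
(`N(v) = 3`, file 249), with `H₀ = diag(1, 1, −1)`:

* **`exists_cells_ncard_and_three_term_record_three`** — cells `gₙ ∈ U(1 ⊗ H₀)` with `deg Tₙ = 28 · 3^{4n−3}`
  (`n ≥ 1`), `deg T₀ = 1`, `T₁ T_{n+2} = T_{n+3} + 2 T_{n+2} + 81 T_{n+1}` and `T₁² = T₂ + 2 T₁ + 84 T₀`;
* **`exists_cells_ncard_one_two_record_three`** — the first three degrees as numerals: `deg T₀ = 1`,
  `deg T₁ = 84`, `deg T₂ = 6804`;
* `exists_generators_and_cells_ncard_and_three_term_record_three` — with the generators `l` of `𝓞_{ℚ(i)}` over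
  `𝓞_{ℚ(i)⁺}` supplied by file 235.

§8(d): uses an L-value-free non-vanishing device: NO.
-/

open Matrix NumberField NumberField.IsCMField IsDedekindDomain IsDedekindDomain.HeightOneSpectrum Module Polynomial
  MulAction
open scoped TensorProduct Pointwise
open Summit.Ventures.HodgeRepro2.T5UnitaryGroupForm Summit.Ventures.HodgeRepro2.T5UnitaryHeckeAdjoint
  Summit.Ventures.HodgeRepro2.T5HeckePermutationModule Summit.Ventures.HodgeRepro2.T5HeckeDoubleCoset
  Summit.Ventures.HodgeRepro2.T5RecordHyperspecial Summit.Ventures.HodgeRepro2.T5GlobalLatticeAlmostAll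
  Summit.Ventures.HodgeRepro2.T5FinitePlaceSplitClassification Summit.Ventures.HodgeRepro2.T5RecordSatakeIntrinsic
  Summit.Ventures.HodgeRepro2.T5CMFieldSquareDatum Summit.Ventures.HodgeRepro2.T5RecordSatakeToy
  Summit.Ventures.HodgeRepro2.T5InertPrimeToy Summit.Ventures.HodgeRepro2.T5CMCensusToy
  Summit.Ventures.HodgeRepro2.T5RecordSatakeInertToy Summit.Ventures.HodgeRepro2.T5RecordSatakeDegreeIntrinsic
  Summit.Ventures.HodgeRepro2.T5RecordSatakeRecurrenceIntrinsic Summit.Ventures.HodgeRepro2.T5SplitPlaceUnitaryGroup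
  Summit.Ventures.HodgeRepro2.T5NonSplitPlaceUnitaryGroup Summit.Ventures.HodgeRepro2.T5FinitePlaceCM
  Summit.Ventures.HodgeRepro2.T5StarOfInvolution Summit.Ventures.HodgeRepro2.T5RecordSatake
  Summit.Ventures.HodgeRepro2.T5RecordSatakeInert Summit.Ventures.HodgeRepro2.T5RecordSatakeCell
  Summit.Ventures.HodgeRepro2.T5RecordSatakeDegree Summit.Ventures.HodgeRepro2.T5RecordSatakeRecurrence
  Summit.Ventures.HodgeRepro2.T5RecordSatakeInertToyDegree Summit.Ventures.HodgeRepro2.T5RecordSatakeDegreeCells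

namespace Summit.Ventures.HodgeRepro2.T5RecordSatakeInertToyCells

section Record

variable (L : Type*) [Field L] [CharZero L] [IsCyclotomicExtension {2 ^ 2} ℚ L]

/-- **THE DEGREES OF ALL THE CELLS AND THE TREE RECURSION AT THE INERT PLACE `(3)` OF `ℚ(i)`, AS NUMERALS**
(file 251's datum-free theorem with `N(v) = 3`: `(N(v)³ + 1) N(v)^{4n−3} = 28 · 3^{4n−3}`, `N(v) − 1 = 2`,
`N(v)⁴ = 81`, `N(v)⁴ + N(v) = 84`): for every family `l` of generators of `𝓞_{ℚ(i)}` over `𝓞_{ℚ(i)⁺}` and every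
field `k` of characteristic `0`, cells `gₙ ∈ U(1 ⊗ H₀)` with `#(K_{(3)} gₙ K_{(3)} / K_{(3)}) = 28 · 3^{4n−3}`
(`n ≥ 1`), `#(K_{(3)} g₀ K_{(3)} / K_{(3)}) = 1`, and `Tₙ := 1_{K_{(3)} gₙ K_{(3)}}` satisfying
`T₁ T_{n+2} = T_{n+3} + 2 T_{n+2} + 81 T_{n+1}` and `T₁² = T₂ + 2 T₁ + 84 T₀`. -/
theorem exists_cells_ncard_and_three_term_record_three (k : Type*) [Field k] [CharZero k] {r : ℕ}
    (l : Fin r → 𝓞 L) (hl : Submodule.span (𝓞 (maximalRealSubfield L)) (Set.range l) = ⊤) :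
    haveI := numberField L; haveI := isCMField_four L
    ∃ g : ℕ → (letI := tensorStarRing L (vThreePlus L);
        ↥(formUnitaryGroup (tensorGram L (vThreePlus L) (gramToy L)))),
      (∀ n, 1 ≤ n → (orbit (recordHyperspecial L (vThreePlus L) l (gramToy L))
        (g n : _ ⧸ recordHyperspecial L (vThreePlus L) l (gramToy L))).ncard = 28 * 3 ^ (4 * n - 3)) ∧
      (orbit (recordHyperspecial L (vThreePlus L) l (gramToy L))
        (g 0 : _ ⧸ recordHyperspecial L (vThreePlus L) l (gramToy L))).ncard = 1 ∧
      ∃ hfin : ∀ n, Finite (orbit (recordHyperspecial L (vThreePlus L) l (gramToy L))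
          (g n : _ ⧸ recordHyperspecial L (vThreePlus L) l (gramToy L))),
        (∀ n, letI := hfin 1; letI := hfin (n + 1 + 1); letI := hfin (n + 1 + 1 + 1); letI := hfin (n + 1);
          doubleCosetOp k (recordHyperspecial L (vThreePlus L) l (gramToy L)) (g 1) *
              doubleCosetOp k (recordHyperspecial L (vThreePlus L) l (gramToy L)) (g (n + 1 + 1)) =
            doubleCosetOp k (recordHyperspecial L (vThreePlus L) l (gramToy L)) (g (n + 1 + 1 + 1)) +
              (2 : k) • doubleCosetOp k (recordHyperspecial L (vThreePlus L) l (gramToy L)) (g (n + 1 + 1)) +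
              (81 : k) • doubleCosetOp k (recordHyperspecial L (vThreePlus L) l (gramToy L)) (g (n + 1))) ∧
        (letI := hfin 1; letI := hfin (0 + 1); letI := hfin (0 + 1 + 1); letI := hfin 0;
          doubleCosetOp k (recordHyperspecial L (vThreePlus L) l (gramToy L)) (g 1) *
              doubleCosetOp k (recordHyperspecial L (vThreePlus L) l (gramToy L)) (g (0 + 1)) =
            doubleCosetOp k (recordHyperspecial L (vThreePlus L) l (gramToy L)) (g (0 + 1 + 1)) +
              (2 : k) • doubleCosetOp k (recordHyperspecial L (vThreePlus L) l (gramToy L)) (g (0 + 1)) +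
              (84 : k) • doubleCosetOp k (recordHyperspecial L (vThreePlus L) l (gramToy L)) (g 0)) := by
  haveI := numberField L
  haveI := isCMField_four L
  have e1 : ((Ideal.absNorm (vThreePlus L).asIdeal : k) - 1) = 2 := by
    rw [absNorm_vThreePlus L]; norm_num
  have e2 : (Ideal.absNorm (vThreePlus L).asIdeal : k) ^ 4 = 81 := by
    rw [absNorm_vThreePlus L]; norm_num
  have e3 : (Ideal.absNorm (vThreePlus L).asIdeal : k) ^ 4 + Ideal.absNorm (vThreePlus L).asIdeal = 84 := by
    rw [absNorm_vThreePlus L]; norm_num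
  have key := @exists_cells_three_term_and_ncard_record_of_staysPrime' L _ (numberField L) (isCMField_four L)
    (vThreePlus L) (wThree L) _ (map_vThreePlus L) _ l k _ _ hl _ gramToy_isHermitian isUnit_det_gramToy
    (notMem_badSet_gramToy _)
  obtain ⟨g, hdeg, hdeg0, hfin, h1, h2⟩ := key
  exact ⟨g, fun n hn => (hdeg n hn).trans (by rw [absNorm_vThreePlus L]; norm_num), hdeg0, hfin,
    fun n => three_term_congr e1 e2 (h1 n), three_term_congr e1 e3 h2⟩

/-- **THE FIRST THREE DEGREES AS NUMERALS**: cells `g₀, g₁, g₂ ∈ U(1 ⊗ H₀)` at `(3)` with `deg T₀ = 1`,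
`deg T₁ = 84` and `deg T₂ = 6804 = 28 · 3⁵`, whose characteristic functions satisfy `T₁² = T₂ + 2 T₁ + 84 T₀`. -/
theorem exists_cells_ncard_one_two_record_three (k : Type*) [Field k] [CharZero k] {r : ℕ}
    (l : Fin r → 𝓞 L) (hl : Submodule.span (𝓞 (maximalRealSubfield L)) (Set.range l) = ⊤) :
    haveI := numberField L; haveI := isCMField_four L
    ∃ g : ℕ → (letI := tensorStarRing L (vThreePlus L);
        ↥(formUnitaryGroup (tensorGram L (vThreePlus L) (gramToy L)))),
      (orbit (recordHyperspecial L (vThreePlus L) l (gramToy L))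
        (g 0 : _ ⧸ recordHyperspecial L (vThreePlus L) l (gramToy L))).ncard = 1 ∧
      (orbit (recordHyperspecial L (vThreePlus L) l (gramToy L))
        (g 1 : _ ⧸ recordHyperspecial L (vThreePlus L) l (gramToy L))).ncard = 84 ∧
      (orbit (recordHyperspecial L (vThreePlus L) l (gramToy L))
        (g 2 : _ ⧸ recordHyperspecial L (vThreePlus L) l (gramToy L))).ncard = 6804 ∧
      ∃ hfin : ∀ n, Finite (orbit (recordHyperspecial L (vThreePlus L) l (gramToy L))
          (g n : _ ⧸ recordHyperspecial L (vThreePlus L) l (gramToy L))),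
        (letI := hfin 1; letI := hfin (0 + 1); letI := hfin (0 + 1 + 1); letI := hfin 0;
          doubleCosetOp k (recordHyperspecial L (vThreePlus L) l (gramToy L)) (g 1) *
              doubleCosetOp k (recordHyperspecial L (vThreePlus L) l (gramToy L)) (g (0 + 1)) =
            doubleCosetOp k (recordHyperspecial L (vThreePlus L) l (gramToy L)) (g (0 + 1 + 1)) +
              (2 : k) • doubleCosetOp k (recordHyperspecial L (vThreePlus L) l (gramToy L)) (g (0 + 1)) +
              (84 : k) • doubleCosetOp k (recordHyperspecial L (vThreePlus L) l (gramToy L)) (g 0)) :=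
  haveI := numberField L
  haveI := isCMField_four L
  (exists_cells_ncard_and_three_term_record_three L k l hl).elim fun g h => h.elim fun hdeg h =>
    h.elim fun hdeg0 h => h.elim fun hfin h => h.elim fun _ h2 =>
      ⟨g, hdeg0, (hdeg 1 le_rfl).trans (by norm_num), (hdeg 2 (by norm_num)).trans (by norm_num), hfin, h2⟩

/-- The cells, their degrees and their recursion at `(3)` with the generators `l` supplied (file 235's
`exists_fin_span_eq_top`). -/
theorem exists_generators_and_cells_ncard_and_three_term_record_three (k : Type*) [Field k] [CharZero k] :
    haveI := numberField L; haveI := isCMField_four L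
    ∃ (r : ℕ) (l : Fin r → 𝓞 L), Submodule.span (𝓞 (maximalRealSubfield L)) (Set.range l) = ⊤ ∧
      ∃ g : ℕ → (letI := tensorStarRing L (vThreePlus L);
          ↥(formUnitaryGroup (tensorGram L (vThreePlus L) (gramToy L)))),
        (∀ n, 1 ≤ n → (orbit (recordHyperspecial L (vThreePlus L) l (gramToy L))
          (g n : _ ⧸ recordHyperspecial L (vThreePlus L) l (gramToy L))).ncard = 28 * 3 ^ (4 * n - 3)) ∧
        (orbit (recordHyperspecial L (vThreePlus L) l (gramToy L))
          (g 0 : _ ⧸ recordHyperspecial L (vThreePlus L) l (gramToy L))).ncard = 1 ∧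
        ∃ hfin : ∀ n, Finite (orbit (recordHyperspecial L (vThreePlus L) l (gramToy L))
            (g n : _ ⧸ recordHyperspecial L (vThreePlus L) l (gramToy L))),
          (∀ n, letI := hfin 1; letI := hfin (n + 1 + 1); letI := hfin (n + 1 + 1 + 1); letI := hfin (n + 1);
            doubleCosetOp k (recordHyperspecial L (vThreePlus L) l (gramToy L)) (g 1) *
                doubleCosetOp k (recordHyperspecial L (vThreePlus L) l (gramToy L)) (g (n + 1 + 1)) =
              doubleCosetOp k (recordHyperspecial L (vThreePlus L) l (gramToy L)) (g (n + 1 + 1 + 1)) +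
                (2 : k) • doubleCosetOp k (recordHyperspecial L (vThreePlus L) l (gramToy L)) (g (n + 1 + 1)) +
                (81 : k) • doubleCosetOp k (recordHyperspecial L (vThreePlus L) l (gramToy L)) (g (n + 1))) ∧
          (letI := hfin 1; letI := hfin (0 + 1); letI := hfin (0 + 1 + 1); letI := hfin 0;
            doubleCosetOp k (recordHyperspecial L (vThreePlus L) l (gramToy L)) (g 1) *
                doubleCosetOp k (recordHyperspecial L (vThreePlus L) l (gramToy L)) (g (0 + 1)) =
              doubleCosetOp k (recordHyperspecial L (vThreePlus L) l (gramToy L)) (g (0 + 1 + 1)) +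
                (2 : k) • doubleCosetOp k (recordHyperspecial L (vThreePlus L) l (gramToy L)) (g (0 + 1)) +
                (84 : k) • doubleCosetOp k (recordHyperspecial L (vThreePlus L) l (gramToy L)) (g 0)) :=
  haveI := numberField L
  haveI := isCMField_four L
  (exists_fin_span_eq_top L).elim fun r h => h.elim fun l hl =>
    ⟨r, l, hl, exists_cells_ncard_and_three_term_record_three L k l hl⟩

end Record

end Summit.Ventures.HodgeRepro2.T5RecordSatakeInertToyCells
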